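import Summits.Ventures.QEC.Census.CertCoverCoset
import HarnessLib

/-!
# Cover reduction, part 4: the level lemmas (one cover step, per problem)
# (qec lane ε, director-qec R29; census/search-9/cover/README.md §2–§3 LEVEL 2→1 and LEVEL 1→0)

Glues parts 1–3 (`CertCover`, `CertCoverSyndrome`, `CertCoverCoset`) into the two statements a cover certificate
uses PER PROBLEM, for one cover step `c : Cover2` (qubits) + `cr : Cover2` (rows of the syndrome matrix `H ↦ Hq`):
* `dbl_eq_clr` — the full fibres of `v` are `clr (P v) (ypart v)`, so `|v| = |P v| + 2·|clr (Pv) (ypart v)|`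
  (`popc_clr_ypart_le`: `|v| ≤ W`, `2f + |P v| ≥ W` ⇒ `|ypart v ∖ P v| ≤ f`);
* `parity_decomp` — for any word `l` upstairs, `⟨l, v⟩ ≡ ⟨l, lift₀ (P v)⟩ + ⟨P l, ypart v⟩ (mod 2)`;
* ★ `level_label_core` (LEVEL 1→0, README «LiftOK(u)»): if the coset problem `P` of `u` passes `cosetOK` against a
  spanning list of `ker Hq`, has `U = u`, `σ = σ(u)`, `2f + |u| ≥ W`, every functional `P l` (`l ∈ Λ`) is even on the
  inside rows `BU`, and every allow-list entry `a` passes the LABEL CHECK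
  `⟨l, lift₀ u⟩ + ⟨P l, y0 ⊕ xorSel G (selOf T a)⟩ ≡ 0`, then EVERY `v < 2^n` with `H v = 0`, `P v = u`, `|v| ≤ W`
  has `⟨l, v⟩ ≡ 0` for all `l ∈ Λ` (with `Λ = LX` upstairs: `v` has label `0`, i.e. is a stabilizer by L1);
* ★ `level_list_core` (LEVEL 2→1): same hypotheses minus the label check ⇒ `v = lift₀ u ⊕ P*(y0 ⊕ xorSel G (selOf T a)
  ⊕ xorSel BU m)` for some allow-listed `a` and some `m < 2^|BU|` — so a certificate that lists, per allow entry and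
  per `BU`-combination, the resulting word covers every such `v`;
* `synEqOK_append` / `synBit_functional` — building the target of an AUGMENTED system `Hq ++ (Λ.map P)` (the level
  2→1 system carries the label functionals that cut `ker H̄^X` down to `C_M`).
What is NOT here: automorphism transport between problems (orbit representatives), the `u = 0` case (it is the
quotient code's own distance theorem), and any code data — those are the assembly files of a specific certificate.

HONEST FRAMING: generic; everything proved; no instances, no notation.
-/

namespace Summit.Ventures.QEC.Census

open Matrix Literature.InformationTheory.QuantumCodes

/-! ## Weight bookkeeping -/

/-- The full fibres of `v` are the bits of `ypart v` off `P v`: `dbl v = clr (P v) (ypart v)`. -/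
theorem Cover2.dbl_eq_clr (c : Cover2) (v : ℕ) : c.dbl v = clr (c.push v) (c.ypart v) := by
  apply Nat.eq_of_testBit_eq; intro p
  rw [testBit_clr]
  by_cases hp : p < c.nq
  · rw [Cover2.testBit_dbl_eq hp]
  · rw [Cover2.dbl, Cover2.ypart, testBit_mkBits_of_le _ (Nat.not_lt.1 hp), testBit_mkBits_of_le _ (Nat.not_lt.1 hp)]
    rfl

/-- **Depth bound**: if `|v| ≤ W` and `2f + |P v| ≥ W` then `|ypart v ∖ P v| ≤ f`. -/
theorem Cover2.popc_clr_ypart_le {c : Cover2} (h : c.ok = true) {v W f : ℕ} (hwt : popc c.n v ≤ W)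
    (hf : W ≤ 2 * f + popc c.nq (c.push v)) : popc c.nq (clr (c.push v) (c.ypart v)) ≤ f := by
  have := Cover2.popc_eq_push_add_two_dbl h v
  rw [Cover2.dbl_eq_clr] at this
  omega

/-! ## Parities through the decomposition -/

/-- **Parity decomposition**: for every word `l` upstairs, `⟨l, v⟩ ≡ ⟨l, lift₀ (P v)⟩ + ⟨P l, ypart v⟩ (mod 2)`
(fibre decomposition + adjointness). -/
theorem Cover2.parity_decomp {c : Cover2} (h : c.ok = true) {v : ℕ} (hv : v < 2 ^ c.n) (l : ℕ) :
    popc c.n (l &&& v) % 2 =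
      (popc c.n (l &&& c.lift0 (c.push v)) + popc c.nq (c.push l &&& c.ypart v)) % 2 := by
  conv_lhs => rw [← Cover2.decomp h hv, Nat.and_xor_distrib_left, popc_xor_mod_two, Nat.add_mod,
    Cover2.popc_and_pull_mod_two h, ← Nat.add_mod]

/-- Clearing bits of `U` does not change the selection read on positions `T` disjoint from `U`. -/
theorem selOf_clr {T : List ℕ} {U : ℕ} (hTU : maskOf T &&& U = 0) (y : ℕ) : selOf T (clr U y) = selOf T y := by
  apply Nat.eq_of_testBit_eq; intro j
  by_cases hj : j < T.length
  · rw [testBit_selOf hj, testBit_selOf hj, testBit_clr]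
    have hmem : T.getD j 0 ∈ T := by
      rw [List.getD_eq_getElem?_getD, List.getElem?_eq_getElem hj, Option.getD_some]; exact List.getElem_mem hj
    have := congrArg (fun x => Nat.testBit x (T.getD j 0)) hTU
    simp only [Nat.testBit_and, testBit_maskOf, Nat.zero_testBit, decide_eq_true hmem, Bool.true_and] at this
    rw [this]
    simp
  · rw [selOf, selOf, testBit_mkBits_of_le _ (Nat.not_lt.1 hj), testBit_mkBits_of_le _ (Nat.not_lt.1 hj)]

/-- `xorSel` only reads the selection word modulo `2^|rows|`. -/
theorem xorSel_mod_two_pow (L : List ℕ) (m : ℕ) : xorSel L m = xorSel L (m % 2 ^ L.length) := by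
  refine xorSel_congr L fun i hi => ?_
  rw [Nat.testBit_mod_two_pow, decide_eq_true hi, Bool.true_and]

/-! ## LEVEL 1→0: the label form -/

/-- **Level lemma, label form** (README §2 «LiftOK(u)», LEVEL 1→0). Cover step `c`/`cr` with row table for the
syndrome matrix (`H` upstairs, `Hq` downstairs), a list `Dq` spanning `ker Hq`, and the coset problem `P` OF `u`
(`U = u`, `σ = σ(u)`, `2f + |u| ≥ W`) passing `cosetOK`; functionals `Λ` (words upstairs) whose push-forwards are even
on the inside rows `BU` and whose LABEL CHECK holds on every allow-list entry. Then every `v < 2^n` with `H v = 0`,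
`P v = u`, `|v| ≤ W` satisfies `⟨l, v⟩ ≡ 0 (mod 2)` for every `l ∈ Λ`. -/
theorem level_label_core {c cr : Cover2} (hc : c.ok = true) (hcr : cr.ok = true) {H Hq Dq : List ℕ}
    (hrows : pushRowsOK c cr H Hq = true)
    (hDq : ∀ z : Fin c.nq → ZMod 2, rowMatrix c.nq Hq *ᵥ z = 0 →
      z ∈ Submodule.span (ZMod 2) (Set.range fun i : Fin Dq.length => ofBits c.nq Dq[i]))
    {P : CosetProb} (hP : cosetOK c.nq Hq Dq P = true) {u W : ℕ} (hU : P.U = u) (hσ : P.sigma = sigmaOf c cr H u)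
    (hf : W ≤ 2 * P.f + popc c.nq u) (Lam : List ℕ)
    (hBU : ∀ l ∈ Lam, ∀ b ∈ P.BU, popc c.nq (c.push l &&& b) % 2 = 0)
    (hallow : ∀ a ∈ P.allow, ∀ l ∈ Lam,
      (popc c.n (l &&& c.lift0 u) + popc c.nq (c.push l &&& (P.y0 ^^^ xorSel P.G (selOf P.T a)))) % 2 = 0)
    {v : ℕ} (hv : v < 2 ^ c.n) (hsyn : synZero c.n H v = true) (hpu : c.push v = u) (hwt : popc c.n v ≤ W) :
    ∀ l ∈ Lam, popc c.n (l &&& v) % 2 = 0 := by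
  subst hpu
  -- the coset equation and the depth bound for y = ypart v
  have hsq : synEqOK c.nq Hq (c.ypart v) P.sigma = true := by
    rw [hσ]; exact synEqOK_ypart_of_synZero hc hcr hrows hv hsyn
  have hdepth : popc c.nq (clr P.U (c.ypart v)) ≤ P.f := by
    rw [hU]; exact Cover2.popc_clr_ypart_le hc hwt hf
  obtain ⟨hmem, m, hy⟩ := coset_sound hP hDq (c.ypart_lt v) hsq hdepth
  -- T ∩ U = ∅ from the checker, to read the selection off the cleared word
  have hTU : maskOf P.T &&& P.U = 0 := by
    simp only [cosetOK, Bool.and_eq_true, beq_iff_eq] at hP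
    exact hP.1.1.1.2
  intro l hl
  have h1 := functional_of_coset (P := P) (Lam := c.push l) (fun b hb => hBU l hl b hb) hy
  have h2 := hallow _ hmem l hl
  rw [selOf_clr hTU] at h2
  rw [Cover2.parity_decomp hc hv l, Nat.add_mod, h1, ← Nat.add_mod]
  exact h2

/-! ## LEVEL 2→1: the list form -/

/-- **Level lemma, list form** (README §3 LEVEL 2→1). Same setting without functionals: every `v < 2^n` with
`H v = 0`, `P v = u`, `|v| ≤ W` is `lift₀ u ⊕ P* (y0 ⊕ xorSel G (selOf T a) ⊕ xorSel BU m)` for some ALLOW-LISTED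
`a` and some `m < 2^|BU|` — the finitely many words a certificate lists (and checks downstream) per problem. -/
theorem level_list_core {c cr : Cover2} (hc : c.ok = true) (hcr : cr.ok = true) {H Hq Dq : List ℕ}
    (hrows : pushRowsOK c cr H Hq = true)
    (hDq : ∀ z : Fin c.nq → ZMod 2, rowMatrix c.nq Hq *ᵥ z = 0 →
      z ∈ Submodule.span (ZMod 2) (Set.range fun i : Fin Dq.length => ofBits c.nq Dq[i]))
    {P : CosetProb} (hP : cosetOK c.nq Hq Dq P = true) {u W : ℕ} (hU : P.U = u) (hσ : P.sigma = sigmaOf c cr H u)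
    (hf : W ≤ 2 * P.f + popc c.nq u)
    {v : ℕ} (hv : v < 2 ^ c.n) (hsyn : synZero c.n H v = true) (hpu : c.push v = u) (hwt : popc c.n v ≤ W) :
    ∃ a ∈ P.allow, ∃ m < 2 ^ P.BU.length,
      v = c.lift0 u ^^^ c.pull (P.y0 ^^^ xorSel P.G (selOf P.T a) ^^^ xorSel P.BU m) := by
  subst hpu
  have hsq : synEqOK c.nq Hq (c.ypart v) P.sigma = true := by
    rw [hσ]; exact synEqOK_ypart_of_synZero hc hcr hrows hv hsyn
  have hdepth : popc c.nq (clr P.U (c.ypart v)) ≤ P.f := by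
    rw [hU]; exact Cover2.popc_clr_ypart_le hc hwt hf
  obtain ⟨hmem, m, hy⟩ := coset_sound hP hDq (c.ypart_lt v) hsq hdepth
  have hTU : maskOf P.T &&& P.U = 0 := by
    simp only [cosetOK, Bool.and_eq_true, beq_iff_eq] at hP
    exact hP.1.1.1.2
  refine ⟨clr P.U (c.ypart v), hmem, m % 2 ^ P.BU.length, Nat.mod_lt _ (Nat.two_pow_pos _), ?_⟩
  rw [selOf_clr hTU, ← xorSel_mod_two_pow, ← hy]
  exact (Cover2.decomp hc hv).symm

/-! ## Augmented systems: syndrome target of `Hq ++ extra rows` -/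

/-- `synEqOK` for a concatenated row list from its two parts, with the target word concatenated at bit `|H₁|`
(`σ₁ < 2^|H₁|`). -/
theorem synEqOK_append {n : ℕ} {H₁ H₂ : List ℕ} {y s₁ s₂ : ℕ} (hs₁ : s₁ < 2 ^ H₁.length)
    (h₁ : synEqOK n H₁ y s₁ = true) (h₂ : synEqOK n H₂ y s₂ = true) :
    synEqOK n (H₁ ++ H₂) y (s₁ + 2 ^ H₁.length * s₂) = true := by
  simp only [synEqOK, List.all_eq_true, List.mem_range, beq_iff_eq] at h₁ h₂ ⊢
  intro r hr
  rw [List.length_append] at hr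
  have hbit : (s₁ + 2 ^ H₁.length * s₂).testBit r =
      if r < H₁.length then s₁.testBit r else s₂.testBit (r - H₁.length) := by
    rw [Nat.add_comm, Nat.testBit_two_pow_mul_add _ hs₁]
  rw [hbit]
  by_cases hlt : r < H₁.length
  · rw [if_pos hlt, ← h₁ r hlt, synBit, synBit, List.getD_eq_getElem?_getD, List.getD_eq_getElem?_getD,
      List.getElem?_append_left hlt]
  · rw [if_neg hlt, ← h₂ (r - H₁.length) (by omega), synBit, synBit, List.getD_eq_getElem?_getD,
      List.getD_eq_getElem?_getD, List.getElem?_append_right (Nat.not_lt.1 hlt)]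

/-- The target word of a descent is below `2^(number of rows downstairs)`. -/
theorem sigmaOf_lt (c cr : Cover2) (H : List ℕ) (u : ℕ) : sigmaOf c cr H u < 2 ^ cr.nq := mkBits_lt _ _

/-- **Functional rows of the augmented system**: for a word `l` upstairs with `⟨l, v⟩ ≡ 0`, the push-forward row
`P l` evaluates on `y = ypart v` to the bit `⟨l, lift₀ (P v)⟩` — so the level-2→1 system `[Hq ; Λ.map P] y = [σ(Pv) ;
(⟨l, lift₀ (P v)⟩)_l]` holds for `y = ypart v` whenever `H v = 0` and `v` is annihilated by `Λ`. -/
theorem synBit_functional {c : Cover2} (hc : c.ok = true) {v : ℕ} (hv : v < 2 ^ c.n) {Lam : List ℕ}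
    (hann : ∀ l ∈ Lam, popc c.n (l &&& v) % 2 = 0) {i : ℕ} (hi : i < Lam.length) :
    synBit c.nq (Lam.map c.push) i (c.ypart v) = synBit c.n Lam i (c.lift0 (c.push v)) := by
  have hl : Lam.getD i 0 ∈ Lam := by
    rw [List.getD_eq_getElem?_getD, List.getElem?_eq_getElem hi, Option.getD_some]; exact List.getElem_mem hi
  have hmap : (Lam.map c.push).getD i 0 = c.push (Lam.getD i 0) := by
    rw [List.getD_eq_getElem?_getD, List.getElem?_map, List.getElem?_eq_getElem hi, Option.map_some,
      Option.getD_some, List.getD_eq_getElem?_getD, List.getElem?_eq_getElem hi, Option.getD_some]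
  have h := Cover2.parity_decomp hc hv (Lam.getD i 0)
  rw [hann _ hl] at h
  unfold synBit
  rw [hmap]
  generalize popc c.n (Lam.getD i 0 &&& c.lift0 (c.push v)) = A at h ⊢
  generalize popc c.nq (c.push (Lam.getD i 0) &&& c.ypart v) = B at h ⊢
  rcases Nat.mod_two_eq_zero_or_one A with hA | hA <;> rcases Nat.mod_two_eq_zero_or_one B with hB | hB <;>
    simp [hA, hB, Nat.add_mod] at h ⊢

/-- **The augmented coset equation** (LEVEL 2→1 system): if `H v = 0` upstairs and `v` is annihilated by every
`l ∈ Λ`, then `y = ypart v` solves `[Hq ; Λ.map P] y = σ(Pv) + 2^|Hq| · synWd n Λ (lift₀ (P v))` (the functional-row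
target word: bit `i` = `⟨Λ[i], lift₀ (P v)⟩ mod 2`). -/
theorem synEqOK_ypart_augmented {c cr : Cover2} (hc : c.ok = true) (hcr : cr.ok = true) {H Hq : List ℕ}
    (hrows : pushRowsOK c cr H Hq = true) {v : ℕ} (hv : v < 2 ^ c.n) (hsyn : synZero c.n H v = true)
    {Lam : List ℕ} (hann : ∀ l ∈ Lam, popc c.n (l &&& v) % 2 = 0) :
    synEqOK c.nq (Hq ++ Lam.map c.push) (c.ypart v)
      (sigmaOf c cr H (c.push v) + 2 ^ Hq.length * synWd c.n Lam (c.lift0 (c.push v))) = true := by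
  have hlen : cr.nq = Hq.length := by
    simp only [pushRowsOK, Bool.and_eq_true, beq_iff_eq] at hrows; exact hrows.1.2
  refine synEqOK_append (hlen ▸ sigmaOf_lt c cr H _) (synEqOK_ypart_of_synZero hc hcr hrows hv hsyn) ?_
  simp only [synEqOK, List.all_eq_true, List.mem_range, beq_iff_eq, List.length_map]
  intro i hi
  rw [synBit_functional hc hv hann hi, synWd, testBit_mkBits_of_lt _ hi]

/-! ## LEVEL 2→1 with the augmented system (appended 2026-08-27, qec-search-9 g3) -/

/-- **Level lemma, list form, AUGMENTED system** (README §3 LEVEL 2→1 as the certificate uses it): the coset problem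
`P` of `u` is checked against the augmented matrix `Hq ++ Λ.map P` (the functionals `Λ` upstairs cut the solutions
down to the sub-code they annihilate, e.g. `C_M`), with target `σ(u) + 2^|Hq| · synWd n Λ (lift₀ u)`; then every
`v < 2^n` with `H v = 0`, ANNIHILATED BY `Λ`, `P v = u`, `|v| ≤ W` is `lift₀ u ⊕ P* (y0 ⊕ xorSel G (selOf T a) ⊕
xorSel BU m)` for some allow-listed `a` and `m < 2^|BU|`. -/
theorem level_list_core_aug {c cr : Cover2} (hc : c.ok = true) (hcr : cr.ok = true) {H Hq Dq : List ℕ}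
    (hrows : pushRowsOK c cr H Hq = true) (Lam : List ℕ)
    (hDq : ∀ z : Fin c.nq → ZMod 2, rowMatrix c.nq (Hq ++ Lam.map c.push) *ᵥ z = 0 →
      z ∈ Submodule.span (ZMod 2) (Set.range fun i : Fin Dq.length => ofBits c.nq Dq[i]))
    {P : CosetProb} (hP : cosetOK c.nq (Hq ++ Lam.map c.push) Dq P = true) {u W : ℕ} (hU : P.U = u)
    (hσ : P.sigma = sigmaOf c cr H u + 2 ^ Hq.length * synWd c.n Lam (c.lift0 u))
    (hf : W ≤ 2 * P.f + popc c.nq u)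
    {v : ℕ} (hv : v < 2 ^ c.n) (hsyn : synZero c.n H v = true) (hann : ∀ l ∈ Lam, popc c.n (l &&& v) % 2 = 0)
    (hpu : c.push v = u) (hwt : popc c.n v ≤ W) :
    ∃ a ∈ P.allow, ∃ m < 2 ^ P.BU.length,
      v = c.lift0 u ^^^ c.pull (P.y0 ^^^ xorSel P.G (selOf P.T a) ^^^ xorSel P.BU m) := by
  subst hpu
  have hsq : synEqOK c.nq (Hq ++ Lam.map c.push) (c.ypart v) P.sigma = true := by
    rw [hσ]; exact synEqOK_ypart_augmented hc hcr hrows hv hsyn hann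
  have hdepth : popc c.nq (clr P.U (c.ypart v)) ≤ P.f := by
    rw [hU]; exact Cover2.popc_clr_ypart_le hc hwt hf
  obtain ⟨hmem, m, hy⟩ := coset_sound hP hDq (c.ypart_lt v) hsq hdepth
  have hTU : maskOf P.T &&& P.U = 0 := by
    simp only [cosetOK, Bool.and_eq_true, beq_iff_eq] at hP
    exact hP.1.1.1.2
  refine ⟨clr P.U (c.ypart v), hmem, m % 2 ^ P.BU.length, Nat.mod_lt _ (Nat.two_pow_pos _), ?_⟩
  rw [selOf_clr hTU, ← xorSel_mod_two_pow, ← hy]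
  exact (Cover2.decomp hc hv).symm

/-- A kernel hypothesis for the augmented system reduces to one for `Hq` alone: `[Hq ; E] z = 0 ⇒ Hq z = 0`. So a
list spanning `ker Hq` (L1 downstairs) serves as `Dq` for `level_list_core_aug`. -/
theorem mulVec_append_left_eq_zero {nq : ℕ} {Hq E : List ℕ} {z : Fin nq → ZMod 2}
    (hz : rowMatrix nq (Hq ++ E) *ᵥ z = 0) : rowMatrix nq Hq *ᵥ z = 0 := by
  funext r
  have h := congrFun hz ⟨r, by rw [List.length_append]; exact Nat.lt_add_right _ r.2⟩
  rw [Pi.zero_apply] at h ⊢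
  rw [← h]
  simp only [mulVec, dotProduct, rowMatrix]
  refine Finset.sum_congr rfl fun j _ => ?_
  congr 2
  exact (List.getElem_append_left (as := Hq) (bs := E) r.2).symm

end Summit.Ventures.QEC.Census
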